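import Summits.Ventures.CertifiedManyBodySolver.Observables.SourcedGibbsTrialCapHFBCS
import Literature.MathematicalPhysics.QuantumLattice.ReducedBCSTorus
import Literature.MathematicalPhysics.QuantumLattice.FermionTorusPlaneWaveInversion
import HarnessLib

/-!
# The HF–BCS sourced cap in momentum space (I): the BdG `2 × 2` block exponential and the Nambu symbol
# of the free `d`-wave pinned torus on plane waves

HONEST FRAMING: zero compute in this file; every statement is a PROVED finite-volume identity / inequality about
the free (`U = 0`) `d`-wave pinned torus and the Hartree–Fock–BCS trial-state cap; no number is claimed here (the
certified interval evaluation of the resulting finite sum is a separate kit job of the `hubbard-obs` cell); a sourced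
variational CAP bounds nothing about order by itself — it feeds the FLOOR edge of the finite-`h` Hellmann–Feynman
bracket only together with a certified source-free lower row; not a statement about order of the source-free model;
not a superconductivity verdict.

Towards the certifiable (momentum-space) form of the Hartree–Fock–BCS sourced cap
`groundEnergy_dWaveSourceTorus_le_HFBCS` (`Observables/SourcedGibbsTrialCapHFBCS.lean`), whose right-hand side is
written with the real-space Fermi matrix `F = (1 + e^{β𝓗})⁻¹` of the `2L² × 2L²` Nambu matrix
`𝓗 = bdgNambuMatrix τ_L Δ_{L,h} μ'`. This file proves:

* §1 `exp_smul_mulVec_of_two_block` (and the companion `'`): if `A v₀ = ξ v₀ + g v₁`, `A v₁ = g v₀ − ξ v₁`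
  (`ξ, g` real, `E = √(ξ² + g²)`), then `e^{βA} v₀ = (cosh βE + ξ sinh(βE)/E) v₀ + (g sinh(βE)/E) v₁` — via the
  eigenvectors `(ξ ± E) v₀ + g v₁` and `HubbardFreePropagator.exp_mulVec_of_mulVec_eq_smul` (no analysis here);
* §2 the plane-wave symbols: `Σ_y τ_L(x,y) χ_k(y) = ε_L(k) χ_k(x)` (`sum_hop_mul_torusChar`, from
  `sum_ite_torusGraph_adj_torusChar`), `Σ_y −(Δ(x,y) + Δ(y,x)) χ_k(y) = 2√2·h·ĝ_d(k)·χ_k(x)`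
  (`sum_gap_mul_torusChar`, `ĝ_d = dWaveGap`), reality of the symmetrised field (`star_gap_eq`), and the action of the
  Nambu matrix on plane waves `𝓗(χ_k ⊗ e_↑) = ξ_k(χ_k ⊗ e_↑) + g_k(χ_k ⊗ e_↓)`, `𝓗(χ_k ⊗ e_↓) = g_k(χ_k ⊗ e_↑) − ξ_k(χ_k ⊗ e_↓)`
  (`dWaveNambu_mulVec_planeWave_zero/one`, generic versions `bdgNambuMatrix_mulVec_planeWave_zero/one`),
  `ξ_k = ε_L(k) − μ'`, `g_k = 2√2 h ĝ_d(k)`, `L ≥ 3`.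

References: Bach–Lieb–Solovej, J. Stat. Phys. 76 (1994) 3, §2 [BachLiebSolovej1994]; von Delft–Ralph,
Phys. Rep. 345 (2001) 61, §4.2 [VondelftRalph2001]; Benfatto–Giuliani–Mastropietro, Ann. Henri Poincaré 7 (2006)
809, eq. (1.4) [BenfattoGiulianiMastropietro2006]; Scalapino, Phys. Rep. 250 (1995) 329, §2 [Scalapino1995].
-/

noncomputable section

open Matrix Finset Literature.MathematicalPhysics.QuantumLattice Literature.Probability.LatticeModels
open scoped ComplexConjugate

namespace Summit.Ventures.CertifiedManyBodySolver.Observables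

/-! ### §1 The exponential of a matrix on a real two-dimensional BdG block -/

section TwoBlock

variable {n : Type*} [Fintype n] [DecidableEq n]

/-- **The exponential of a matrix on a real `2 × 2` traceless-symmetric block.** If `A v₀ = ξ v₀ + g v₁` and
`A v₁ = g v₀ − ξ v₁` (`ξ, g` real, `E = √(ξ² + g²)`), then
`e^{βA} v₀ = (cosh βE + ξ sinh(βE)/E) v₀ + (g sinh(βE)/E) v₁` (with Lean's `x/0 = 0` the formula is also
correct in the degenerate case `E = 0`, where `A v₀ = 0`). The BdG `2 × 2` block algebra behind the BCS
quasi-particle spectrum `±E_k`. [cite: VondelftRalph2001, §4.2] -/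
theorem exp_smul_mulVec_of_two_block (A : Matrix n n ℂ) {v₀ v₁ : n → ℂ} (β ξ g : ℝ)
    (h0 : A *ᵥ v₀ = (ξ : ℂ) • v₀ + (g : ℂ) • v₁) (h1 : A *ᵥ v₁ = (g : ℂ) • v₀ - (ξ : ℂ) • v₁) :
    NormedSpace.exp ((β : ℂ) • A) *ᵥ v₀ =
      ((Real.cosh (β * Real.sqrt (ξ ^ 2 + g ^ 2)) +
          ξ * (Real.sinh (β * Real.sqrt (ξ ^ 2 + g ^ 2)) / Real.sqrt (ξ ^ 2 + g ^ 2)) : ℝ) : ℂ) • v₀ +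
      ((g * (Real.sinh (β * Real.sqrt (ξ ^ 2 + g ^ 2)) / Real.sqrt (ξ ^ 2 + g ^ 2)) : ℝ) : ℂ) • v₁ := by
  set E := Real.sqrt (ξ ^ 2 + g ^ 2) with hE
  have hE2 : E ^ 2 = ξ ^ 2 + g ^ 2 := Real.sq_sqrt (by positivity)
  rcases eq_or_ne E 0 with hE0 | hE0
  · -- degenerate block: `ξ = g = 0`, `A v₀ = 0`
    rw [hE0] at hE2
    have hξ : ξ = 0 := by nlinarith [sq_nonneg ξ, sq_nonneg g]
    have hg : g = 0 := by nlinarith [sq_nonneg ξ, sq_nonneg g]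
    have hv : ((β : ℂ) • A) *ᵥ v₀ = (0 : ℂ) • v₀ := by
      rw [Matrix.smul_mulVec, h0, hξ, hg]
      simp
    rw [exp_mulVec_of_mulVec_eq_smul _ hv, hE0, hξ, hg]
    simp
  · -- eigenvectors `V± = (ξ ± E) v₀ + g v₁` with eigenvalues `±βE`
    have key : ∀ s : ℝ, s ^ 2 = ξ ^ 2 + g ^ 2 →
        ((β : ℂ) • A) *ᵥ ((((ξ + s : ℝ)) : ℂ) • v₀ + (g : ℂ) • v₁) =
          ((β * s : ℝ) : ℂ) • ((((ξ + s : ℝ)) : ℂ) • v₀ + (g : ℂ) • v₁) := by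
      intro s hs
      rw [Matrix.smul_mulVec, Matrix.mulVec_add, Matrix.mulVec_smul, Matrix.mulVec_smul, h0, h1]
      ext i
      simp only [Pi.add_apply, Pi.smul_apply, Pi.sub_apply, smul_eq_mul]
      have hs' : (s : ℂ) ^ 2 = (ξ : ℂ) ^ 2 + (g : ℂ) ^ 2 := by exact_mod_cast hs
      push_cast
      linear_combination (-(β : ℂ)) * v₀ i * hs'
    have hp := exp_mulVec_of_mulVec_eq_smul _ (key E hE2)
    have hm := exp_mulVec_of_mulVec_eq_smul _ (key (-E) (by rw [neg_sq]; exact hE2))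
    have hE0' : (E : ℂ) ≠ 0 := by exact_mod_cast hE0
    have hv0 : v₀ = ((2 * E : ℝ) : ℂ)⁻¹ •
        (((((ξ + E : ℝ)) : ℂ) • v₀ + (g : ℂ) • v₁) - ((((ξ + -E : ℝ)) : ℂ) • v₀ + (g : ℂ) • v₁)) := by
      ext i
      simp only [Pi.add_apply, Pi.smul_apply, Pi.sub_apply, smul_eq_mul]
      push_cast
      field_simp
      ring
    calc NormedSpace.exp ((β : ℂ) • A) *ᵥ v₀
        = ((2 * E : ℝ) : ℂ)⁻¹ • (NormedSpace.exp ((β : ℂ) • A) *ᵥ ((((ξ + E : ℝ)) : ℂ) • v₀ + (g : ℂ) • v₁) -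
            NormedSpace.exp ((β : ℂ) • A) *ᵥ ((((ξ + -E : ℝ)) : ℂ) • v₀ + (g : ℂ) • v₁)) := by
          conv_lhs => rw [hv0]
          rw [Matrix.mulVec_smul, Matrix.mulVec_sub]
      _ = ((2 * E : ℝ) : ℂ)⁻¹ • (Complex.exp ((β * E : ℝ) : ℂ) • ((((ξ + E : ℝ)) : ℂ) • v₀ + (g : ℂ) • v₁) -
            Complex.exp ((β * -E : ℝ) : ℂ) • ((((ξ + -E : ℝ)) : ℂ) • v₀ + (g : ℂ) • v₁)) := by rw [hp, hm]
      _ = _ := by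
          ext i
          simp only [Pi.add_apply, Pi.smul_apply, Pi.sub_apply, smul_eq_mul]
          rw [Real.cosh_eq, Real.sinh_eq]
          have e1 : ((β * -E : ℝ) : ℂ) = -((β * E : ℝ) : ℂ) := by push_cast; ring
          rw [e1]
          push_cast
          field_simp
          ring

/-- The companion formula for the second block vector: under the hypotheses of
`exp_smul_mulVec_of_two_block`, `e^{βA} v₁ = (g sinh(βE)/E) v₀ + (cosh βE − ξ sinh(βE)/E) v₁`.
[cite: VondelftRalph2001, §4.2] -/
theorem exp_smul_mulVec_of_two_block' (A : Matrix n n ℂ) {v₀ v₁ : n → ℂ} (β ξ g : ℝ)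
    (h0 : A *ᵥ v₀ = (ξ : ℂ) • v₀ + (g : ℂ) • v₁) (h1 : A *ᵥ v₁ = (g : ℂ) • v₀ - (ξ : ℂ) • v₁) :
    NormedSpace.exp ((β : ℂ) • A) *ᵥ v₁ =
      ((g * (Real.sinh (β * Real.sqrt (ξ ^ 2 + g ^ 2)) / Real.sqrt (ξ ^ 2 + g ^ 2)) : ℝ) : ℂ) • v₀ +
      ((Real.cosh (β * Real.sqrt (ξ ^ 2 + g ^ 2)) -
          ξ * (Real.sinh (β * Real.sqrt (ξ ^ 2 + g ^ 2)) / Real.sqrt (ξ ^ 2 + g ^ 2)) : ℝ) : ℂ) • v₁ := by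
  have h1' : A *ᵥ v₁ = ((-ξ : ℝ) : ℂ) • v₁ + (g : ℂ) • v₀ := by
    rw [h1]; push_cast; module
  have h0' : A *ᵥ v₀ = (g : ℂ) • v₁ - ((-ξ : ℝ) : ℂ) • v₀ := by
    rw [h0]; push_cast; module
  have h := exp_smul_mulVec_of_two_block A β (-ξ) g h1' h0'
  rw [neg_sq] at h
  rw [h, add_comm]
  congr 1
  push_cast
  ring_nf

end TwoBlock

/-! ### §2 The Nambu symbol of the free `d`-wave pinned torus on plane waves -/

section Symbol

variable {L : ℕ} [NeZero L]

/-- `x = ofTorusSite z ↔ x.toTorusSite = z` on the fermionic torus. [folklore] -/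
theorem FermionTorus.eq_ofTorusSite_iff {d : ℕ} (x : FermionTorus d L) (z : TorusSite d L) :
    x = FermionTorus.ofTorusSite z ↔ x.toTorusSite = z := by
  constructor
  · rintro rfl; exact FermionTorus.toTorusSite_ofTorusSite z
  · rintro rfl; exact (FermionTorus.ofTorusSite_toTorusSite x).symm

/-- **Hopping symbol**: `Σ_y τ_L(x,y) χ_k(y) = ε_L(k) χ_k(x)` for the torus hopping `τ_L(x,y) = -[x ∼ y]`
(`L ≥ 3`). [cite: BenfattoGiulianiMastropietro2006, eq. (1.4)] -/
theorem sum_hop_mul_torusChar (hL : 3 ≤ L) (k : TorusSite 2 L) (x : FermionTorus 2 L) :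
    ∑ y : FermionTorus 2 L, (if (fermionTorusGraph 2 L).Adj x y then -(1 : ℂ) else 0) *
        torusChar k y.toTorusSite = ((torusBand L k : ℝ) : ℂ) * torusChar k x.toTorusSite := by
  have h1 : ∀ y : FermionTorus 2 L, (if (fermionTorusGraph 2 L).Adj x y then -(1 : ℂ) else 0) *
      torusChar k y.toTorusSite =
      -(if (torusGraph 2 L).Adj x.toTorusSite y.toTorusSite then torusChar k y.toTorusSite else 0) := by
    intro y
    by_cases hxy : (fermionTorusGraph 2 L).Adj x y
    · rw [if_pos hxy, if_pos ((fermionTorusGraph_adj x y).mp hxy)]; ring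
    · rw [if_neg hxy, if_neg (fun h' => hxy ((fermionTorusGraph_adj x y).mpr h'))]; ring
  rw [Finset.sum_congr rfl fun y _ => h1 y, Finset.sum_neg_distrib, FermionTorus.sum_eq_sum_torusSite]
  simp only [FermionTorus.toTorusSite_ofTorusSite]
  rw [sum_ite_torusGraph_adj_torusChar hL k x.toTorusSite]
  unfold torusBand
  push_cast
  ring

/-- Transposed hopping symbol: `Σ_y τ_L(y,x) χ_k(y) = ε_L(k) χ_k(x)` (`L ≥ 3`).
[cite: BenfattoGiulianiMastropietro2006, eq. (1.4)] -/
theorem sum_hop_mul_torusChar' (hL : 3 ≤ L) (k : TorusSite 2 L) (x : FermionTorus 2 L) :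
    ∑ y : FermionTorus 2 L, (if (fermionTorusGraph 2 L).Adj y x then -(1 : ℂ) else 0) *
        torusChar k y.toTorusSite = ((torusBand L k : ℝ) : ℂ) * torusChar k x.toTorusSite := by
  rw [← sum_hop_mul_torusChar hL k x]
  refine Finset.sum_congr rfl fun y _ => ?_
  by_cases hxy : (fermionTorusGraph 2 L).Adj x y
  · rw [if_pos hxy, if_pos hxy.symm]
  · rw [if_neg hxy, if_neg (fun h' => hxy h'.symm)]

/-- **Pairing symbol**: for the `d`-wave bond field `Δ_{L,h}(u,v) = -h Σᵢ √2 sᵢ [v = u + eᵢ]` (`s = (+1,-1)`),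
`Σ_y -(Δ(x,y) + Δ(y,x)) χ_k(y) = 2√2·h·ĝ_d(k)·χ_k(x)`, `ĝ_d(k) = cos k₁ - cos k₂` (`L ≥ 3`).
[cite: Scalapino1995, §2] -/
theorem sum_gap_mul_torusChar (hL : 3 ≤ L) (h : ℝ) (k : TorusSite 2 L) (x : FermionTorus 2 L) :
    ∑ y : FermionTorus 2 L,
        -((-(h : ℂ) * ∑ i : Fin 2,
            if y = FermionTorus.ofTorusSite (x.toTorusSite + Pi.single i 1) then
              ((Real.sqrt 2 * (if i = 0 then 1 else -1) : ℝ) : ℂ) else 0) +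
          (-(h : ℂ) * ∑ i : Fin 2,
            if x = FermionTorus.ofTorusSite (y.toTorusSite + Pi.single i 1) then
              ((Real.sqrt 2 * (if i = 0 then 1 else -1) : ℝ) : ℂ) else 0)) * torusChar k y.toTorusSite =
      ((2 * Real.sqrt 2 * h * dWaveGap k : ℝ) : ℂ) * torusChar k x.toTorusSite := by
  -- rewrite the indicators in `toTorusSite` form and distribute
  have hterm : ∀ y : FermionTorus 2 L,
      -((-(h : ℂ) * ∑ i : Fin 2,
            if y = FermionTorus.ofTorusSite (x.toTorusSite + Pi.single i 1) then
              ((Real.sqrt 2 * (if i = 0 then 1 else -1) : ℝ) : ℂ) else 0) +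
          (-(h : ℂ) * ∑ i : Fin 2,
            if x = FermionTorus.ofTorusSite (y.toTorusSite + Pi.single i 1) then
              ((Real.sqrt 2 * (if i = 0 then 1 else -1) : ℝ) : ℂ) else 0)) * torusChar k y.toTorusSite =
        (h : ℂ) * ∑ i : Fin 2,
          ((if y.toTorusSite = x.toTorusSite + Pi.single i 1 then
              ((Real.sqrt 2 * (if i = 0 then 1 else -1) : ℝ) : ℂ) else 0) * torusChar k y.toTorusSite +
           (if x.toTorusSite = y.toTorusSite + Pi.single i 1 then
              ((Real.sqrt 2 * (if i = 0 then 1 else -1) : ℝ) : ℂ) else 0) * torusChar k y.toTorusSite) := by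
    intro y
    simp only [FermionTorus.eq_ofTorusSite_iff, Fin.sum_univ_two]
    ring
  rw [Finset.sum_congr rfl fun y _ => hterm y, ← Finset.mul_sum, Finset.sum_comm]
  have hi : ∀ i : Fin 2, ∑ y : FermionTorus 2 L,
      ((if y.toTorusSite = x.toTorusSite + Pi.single i 1 then
          ((Real.sqrt 2 * (if i = 0 then 1 else -1) : ℝ) : ℂ) else 0) * torusChar k y.toTorusSite +
        (if x.toTorusSite = y.toTorusSite + Pi.single i 1 then
          ((Real.sqrt 2 * (if i = 0 then 1 else -1) : ℝ) : ℂ) else 0) * torusChar k y.toTorusSite) =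
      ((Real.sqrt 2 * (if i = 0 then 1 else -1) : ℝ) : ℂ) *
        (((2 * Real.cos (latticeMomentum L k i) : ℝ) : ℂ) * torusChar k x.toTorusSite) := by
    intro i
    rw [Finset.sum_add_distrib, sum_ite_shift_mul x (Pi.single i 1) _ (torusChar k),
      sum_ite_unshift_mul x (Pi.single i 1) _ (torusChar k), ← mul_add, torusChar_add_right,
      torusChar_sub_right, ← mul_add, torusChar_single_add_conj (by omega) k i, mul_comm (torusChar k _)]
  simp only [hi, Fin.sum_univ_two, Fin.one_eq_zero_iff, if_true, OfNat.ofNat_ne_one, if_false]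
  unfold dWaveGap
  push_cast
  ring

/-- The symmetrised `d`-wave bond field is real: `conj(Δ(x,y) + Δ(y,x)) = Δ(x,y) + Δ(y,x)`. [cite: Scalapino1995, §2] -/
theorem star_gap_eq (h : ℝ) (x y : FermionTorus 2 L) :
    star ((-(h : ℂ) * ∑ i : Fin 2,
            if y = FermionTorus.ofTorusSite (x.toTorusSite + Pi.single i 1) then
              ((Real.sqrt 2 * (if i = 0 then 1 else -1) : ℝ) : ℂ) else 0) +
          (-(h : ℂ) * ∑ i : Fin 2,
            if x = FermionTorus.ofTorusSite (y.toTorusSite + Pi.single i 1) then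
              ((Real.sqrt 2 * (if i = 0 then 1 else -1) : ℝ) : ℂ) else 0)) =
      (-(h : ℂ) * ∑ i : Fin 2,
            if y = FermionTorus.ofTorusSite (x.toTorusSite + Pi.single i 1) then
              ((Real.sqrt 2 * (if i = 0 then 1 else -1) : ℝ) : ℂ) else 0) +
          (-(h : ℂ) * ∑ i : Fin 2,
            if x = FermionTorus.ofTorusSite (y.toTorusSite + Pi.single i 1) then
              ((Real.sqrt 2 * (if i = 0 then 1 else -1) : ℝ) : ℂ) else 0) := by
  simp only [Fin.sum_univ_two, Fin.one_eq_zero_iff, if_true, OfNat.ofNat_ne_one, if_false, star_add, star_mul',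
    star_neg, Complex.star_def, Complex.conj_ofReal, apply_ite (starRingEnd ℂ), map_zero]

/-- **A translation-invariant Nambu matrix on plane waves, particle component** (generic symbol form):
if the hopping `τ` has plane-wave symbol `ε` (from both sides) and the symmetrised pair field `-(Δ + Δᵀ)` has
the real symbol `g`, then `bdgNambuMatrix τ Δ μ'` maps `χ_k ⊗ e_↑ ↦ (ε - μ')(χ_k ⊗ e_↑) + g (χ_k ⊗ e_↓)`.
[cite: BachLiebSolovej1994, §2] -/
theorem bdgNambuMatrix_mulVec_planeWave_zero (τ Δ : FermionTorus 2 L → FermionTorus 2 L → ℂ) (μ' ε g : ℝ)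
    (k : TorusSite 2 L)
    (hτ : ∀ x : FermionTorus 2 L, ∑ y, τ x y * torusChar k y.toTorusSite = (ε : ℂ) * torusChar k x.toTorusSite)
    (hΔ : ∀ x : FermionTorus 2 L,
      ∑ y, -(Δ x y + Δ y x) * torusChar k y.toTorusSite = (g : ℂ) * torusChar k x.toTorusSite) :
    bdgNambuMatrix τ Δ μ' *ᵥ planeWave k 0 =
      ((ε - μ' : ℝ) : ℂ) • planeWave k 0 + (g : ℂ) • planeWave k 1 := by
  funext o
  obtain ⟨⟨x, σ⟩, rfl⟩ : ∃ p : FermionTorus 2 L × Fin 2, toLex p = o := ⟨ofLex o, toLex_ofLex o⟩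
  change (_ *ᵥ planeWave k 0) (orb x σ) = _
  simp only [Matrix.mulVec, dotProduct, Pi.add_apply, Pi.smul_apply, smul_eq_mul]
  rw [sum_orb_eq_sum_sum]
  simp only [planeWave_orb, mul_ite, mul_zero, Finset.sum_ite_eq', Finset.mem_univ, if_true]
  by_cases hσ : σ = 0
  · subst hσ
    simp only [bdgNambuMatrix_orb_orb, if_true, sub_mul, Finset.sum_sub_distrib]
    rw [hτ x]
    simp only [ite_mul, zero_mul, Finset.sum_ite_eq, Finset.mem_univ, if_true]
    push_cast
    ring
  · obtain rfl : σ = 1 := Fin.eq_one_of_ne_zero σ hσ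
    simp only [bdgNambuMatrix_orb_orb, one_ne_zero, if_false, if_true, zero_add]
    exact hΔ x

/-- **A translation-invariant Nambu matrix on plane waves, hole component** (generic symbol form):
`bdgNambuMatrix τ Δ μ'` maps `χ_k ⊗ e_↓ ↦ g (χ_k ⊗ e_↑) - (ε - μ')(χ_k ⊗ e_↓)`. [cite: BachLiebSolovej1994, §2] -/
theorem bdgNambuMatrix_mulVec_planeWave_one (τ Δ : FermionTorus 2 L → FermionTorus 2 L → ℂ) (μ' ε g : ℝ)
    (k : TorusSite 2 L)
    (hτ' : ∀ x : FermionTorus 2 L, ∑ y, τ y x * torusChar k y.toTorusSite = (ε : ℂ) * torusChar k x.toTorusSite)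
    (hΔ : ∀ x : FermionTorus 2 L,
      ∑ y, -(Δ x y + Δ y x) * torusChar k y.toTorusSite = (g : ℂ) * torusChar k x.toTorusSite)
    (hΔreal : ∀ x y : FermionTorus 2 L, star (Δ x y + Δ y x) = Δ x y + Δ y x) :
    bdgNambuMatrix τ Δ μ' *ᵥ planeWave k 1 =
      (g : ℂ) • planeWave k 0 - ((ε - μ' : ℝ) : ℂ) • planeWave k 1 := by
  funext o
  obtain ⟨⟨x, σ⟩, rfl⟩ : ∃ p : FermionTorus 2 L × Fin 2, toLex p = o := ⟨ofLex o, toLex_ofLex o⟩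
  change (_ *ᵥ planeWave k 1) (orb x σ) = _
  simp only [Matrix.mulVec, dotProduct, Pi.sub_apply, Pi.smul_apply, smul_eq_mul]
  rw [sum_orb_eq_sum_sum]
  simp only [planeWave_orb, mul_ite, mul_zero, Finset.sum_ite_eq', Finset.mem_univ, if_true]
  by_cases hσ : σ = 0
  · subst hσ
    simp only [bdgNambuMatrix_orb_orb, if_true, one_ne_zero, if_false, zero_ne_one, sub_zero, hΔreal]
    exact hΔ x
  · obtain rfl : σ = 1 := Fin.eq_one_of_ne_zero σ hσ
    simp only [bdgNambuMatrix_orb_orb, one_ne_zero, if_false, if_true, zero_sub, add_mul, neg_mul,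
      Finset.sum_add_distrib, Finset.sum_neg_distrib]
    rw [hτ' x]
    simp only [ite_mul, zero_mul, Finset.sum_ite_eq, Finset.mem_univ, if_true]
    push_cast
    ring

/-- **The Nambu symbol on plane waves, particle component**: with `ξ_k = ε_L(k) - μ'`,
`g_k = 2√2 h ĝ_d(k)`, the Nambu matrix `𝓗_{L,μ',h}` of the free `d`-wave pinned torus maps
`χ_k ⊗ e_↑ ↦ ξ_k (χ_k ⊗ e_↑) + g_k (χ_k ⊗ e_↓)` (`L ≥ 3`). [cite: BachLiebSolovej1994, §2] -/
theorem dWaveNambu_mulVec_planeWave_zero (hL : 3 ≤ L) (μ' h : ℝ) (k : TorusSite 2 L) :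
    bdgNambuMatrix
        (fun x y => if (fermionTorusGraph 2 L).Adj x y then -(1 : ℂ) else 0)
        (fun u v : FermionTorus 2 L => -(h : ℂ) * ∑ i : Fin 2,
          if v = FermionTorus.ofTorusSite (u.toTorusSite + Pi.single i 1) then
            ((Real.sqrt 2 * (if i = 0 then 1 else -1) : ℝ) : ℂ) else 0) μ' *ᵥ planeWave k 0 =
      ((torusBand L k - μ' : ℝ) : ℂ) • planeWave k 0 +
        ((2 * Real.sqrt 2 * h * dWaveGap k : ℝ) : ℂ) • planeWave k 1 :=
  bdgNambuMatrix_mulVec_planeWave_zero _ _ μ' (torusBand L k) (2 * Real.sqrt 2 * h * dWaveGap k) k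
    (sum_hop_mul_torusChar hL k) (sum_gap_mul_torusChar hL h k)

/-- **The Nambu symbol on plane waves, hole component**: `𝓗_{L,μ',h}` maps
`χ_k ⊗ e_↓ ↦ g_k (χ_k ⊗ e_↑) - ξ_k (χ_k ⊗ e_↓)` (`L ≥ 3`). [cite: BachLiebSolovej1994, §2] -/
theorem dWaveNambu_mulVec_planeWave_one (hL : 3 ≤ L) (μ' h : ℝ) (k : TorusSite 2 L) :
    bdgNambuMatrix
        (fun x y => if (fermionTorusGraph 2 L).Adj x y then -(1 : ℂ) else 0)
        (fun u v : FermionTorus 2 L => -(h : ℂ) * ∑ i : Fin 2,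
          if v = FermionTorus.ofTorusSite (u.toTorusSite + Pi.single i 1) then
            ((Real.sqrt 2 * (if i = 0 then 1 else -1) : ℝ) : ℂ) else 0) μ' *ᵥ planeWave k 1 =
      ((2 * Real.sqrt 2 * h * dWaveGap k : ℝ) : ℂ) • planeWave k 0 -
        ((torusBand L k - μ' : ℝ) : ℂ) • planeWave k 1 :=
  bdgNambuMatrix_mulVec_planeWave_one _ _ μ' (torusBand L k) (2 * Real.sqrt 2 * h * dWaveGap k) k
    (sum_hop_mul_torusChar' hL k) (sum_gap_mul_torusChar hL h k) (star_gap_eq h)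

end Symbol

end Summit.Ventures.CertifiedManyBodySolver.Observables

end
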